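import Summits.Ventures.Crystal3D.Theorems.StickyWulffConstantTextureBuildRiserClaim
import Summits.Ventures.Crystal3D.Theorems.StickyWulffConstantTextureBuildRiserWallArea
import Summits.Ventures.Crystal3D.Theorems.StickyWulffConstantTextureBuildMeshV7
import HarnessLib

/-!
# The RISER PACKAGE (B6), part 12: WHICH CURTAIN TERMS SURVIVE, and who pays for them
# (lane T, crux `TextureLiminfV5`, stmt-Ventures-23912; design memo HOME/wulff-p2/g21/B6-DESIGN-g21.md §3 (curtains); target `RiserPackage₇` of '…TextureBuildMeshV7')

HONEST FRAMING. Venture `Summits/Ventures/Crystal3D` (cell `crystal3d-full`), route `route-Ventures-StickyWulffConstant`, helper `--supports` the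
law-v5 crux `TextureLiminfV5` (stmt-Ventures-23912).  Standard axioms; no mesh constructed; F-C1 not moved.

A term of `curtainSpecialSum` is `lawW · facetArea (contact i i' p)` for two riser-box cells of different classes and a horizontal datum `p`.
* `TexInput.mem_Hp_of_subset`, `mem_Hp_or_antip_mem`, `lawW_mul_facetArea_eq_zero_of_generic`, `facetArea_contact_eq_zero_of_no_generic`,
  `facetArea_contact_eq_zero_of_mem_both`, `facetArea_contact_antip` — bookkeeping on contacts;
* **`Mesh₅.curtain_term_zero_or_key`** — a curtain term VANISHES, or (KEY⁺) `i` is `f`-claimed in the prism `G_c` of an occupied riser site `c`, `i'` is a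
  default cell of the same box and `p` is a WALL datum of `G_c`, or (KEY⁻) the same with the roles exchanged (`antip p` the wall datum);
* **`Mesh₅.facetArea_eq_zero_of_occupied_neighbour`** — a KEY⁺ term whose neighbouring site `c + d` across the wall is OCCUPIED has null contact
  (the default cell would ENTER `G_{c+d}` and be claimed);
* **`Mesh₇.owner_of_key`** — a KEY⁺ term with non-null contact is PAID FOR: `c` is owned by a riser piece `r'` of the same column pair (`hBhalo`), the
  vacant neighbour `c + d` is one of its in-plane sites (`hBV`), and the owner's normal is `± rn r` (`hBownRn`, Δ7).
-/

noncomputable section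

open scoped BigOperators InnerProductSpace

namespace Summit.Ventures.Crystal3D.Cruxes.TextureLiminf.TexShadow

open Summit.Ventures.Crystal3D Summit.Ventures.Crystal3D.Theorems Set
open Summit.Ventures.Crystal3D.TentCertificate (hB hB_sq hB_pos)

namespace TexInput

variable {C R₀ : ℝ} {N : ℕ} {x : Fin N → E3} {rc : RiseredCover C R₀ N x} {δ : ℝ} {μ : Mesh₅ rc δ} (I : TexInput rc μ)

/-! ### Contact bookkeeping -/

/-- The data of a container holding the piece are among the piece's signed constraints. -/
theorem mem_Hp_of_subset {i : Fin I.cells.M} {G : Finset (E3 × ℝ)} (hG : G ⊆ I.𝓗) (hi : polytope (I.cells.Hp i) ⊆ polytope G) {q : E3 × ℝ}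
    (hq : q ∈ G) : q ∈ I.cells.Hp i :=
  mem_signedH_iff.2 ⟨q, hG hq, Or.inl ⟨subset_T_of_cell_subset hG (I.cells.hne _) hi hq, rfl⟩⟩

/-- Every arrangement datum or its antipode is a signed constraint of every piece. -/
theorem mem_Hp_or_antip_mem (i : Fin I.cells.M) {q : E3 × ℝ} (hq : q ∈ I.𝓗) : q ∈ I.cells.Hp i ∨ antip q ∈ I.cells.Hp i := by
  by_cases h : q ∈ I.cells.T (I.cells.idx i)
  · exact Or.inl (mem_signedH_iff.2 ⟨q, hq, Or.inl ⟨h, rfl⟩⟩)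
  · exact Or.inr (mem_signedH_iff.2 ⟨q, hq, Or.inr ⟨h, rfl⟩⟩)

/-- **No generic contact point ⇒ the contact is null.** -/
theorem facetArea_contact_eq_zero_of_no_generic {i i' : Fin I.cells.M} {p : E3 × ℝ} (hp : p ∈ I.cells.Hp i)
    (h : ∀ y ∈ I.contact i i' p, ¬ I.Generic p y) : facetArea (I.contact i i' p) p.1 = 0 := by
  refine le_antisymm ?_ (facetArea_nonneg _ _)
  rw [← I.facetArea_nonGeneric_eq_zero' i hp]
  refine facetArea_mono_of_subset (I.cells.hbd_Hp i) (fun z hz => hz.1) (fun z hz => ?_) p.1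
  exact ⟨hz.1.1, hz.1.2, h z hz⟩

/-- **The weighted term vanishes if the weight vanishes at every generic contact point.** -/
theorem lawW_mul_facetArea_eq_zero_of_generic {i i' : Fin I.cells.M} {p : E3 × ℝ} (hp : p ∈ I.cells.Hp i)
    (h : ∀ y ∈ I.contact i i' p, I.Generic p y → lawW I.frameOf (I.cells.cls i) (I.cells.cls i') p.1 = 0) :
    lawW I.frameOf (I.cells.cls i) (I.cells.cls i') p.1 * facetArea (I.contact i i' p) p.1 = 0 := by
  by_cases hex : ∃ y ∈ I.contact i i' p, I.Generic p y
  · obtain ⟨y, hy, hg⟩ := hex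
    rw [h y hy hg, zero_mul]
  · push Not at hex
    rw [I.facetArea_contact_eq_zero_of_no_generic hp hex, mul_zero]

/-- **Two pieces on the same side of the plane have null contact along it.** -/
theorem facetArea_contact_eq_zero_of_mem_both {i i' : Fin I.cells.M} (hne : i ≠ i') {p : E3 × ℝ} (hp : p ∈ I.cells.Hp i)
    (hp' : p ∈ I.cells.Hp i') : facetArea (I.contact i i' p) p.1 = 0 := by
  have h := facetArea_inter_eq_zero_of_sameSide (I.cells.hunit_Hp i p hp) (polytope_subset_halfspace hp) (polytope_subset_halfspace hp')
    (I.cells.hdisj_Hp i i' hne)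
  have hset : I.contact i i' p = closure (polytope (I.cells.Hp i)) ∩ closure (polytope (I.cells.Hp i')) ∩ {x : E3 | ⟪p.1, x⟫_ℝ = p.2} := by
    ext y; simp only [contact, mem_inter_iff, mem_setOf_eq]; tauto
  rw [hset]; exact h

/-- The contact area read from the other side. -/
theorem facetArea_contact_antip (i i' : Fin I.cells.M) (q : E3 × ℝ) :
    facetArea (I.contact i i' (antip q)) (antip q).1 = facetArea (I.contact i' i q) q.1 := by
  rw [I.contact_antip_comm]
  exact facetArea_neg _ _

end TexInput

namespace Mesh₅

variable {C R₀ : ℝ} {N : ℕ} {x : Fin N → E3} {rc : RiseredCover C R₀ N x} {δ : ℝ} (μ : Mesh₅ rc δ)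
  (ct : (f : Fin rc.ng) → TentCert (rc.tent f)) (τ : Fin rc.nk → ℝ)

/-! ### Which curtain terms survive -/

/-- **A CURTAIN TERM VANISHES, OR IT IS A WALL TERM** (KEY⁺: `i ⊆ G_c` claimed, `p` a wall datum of `G_c`; KEY⁻: the same for `i'` and `antip p`). -/
theorem curtain_term_zero_or_key {i i' : Fin (μ.riserInput ct τ).cells.M}
    (hcls : (μ.riserInput ct τ).cells.cls i' ≠ (μ.riserInput ct τ).cells.cls i) {p : E3 × ℝ} (hp : p ∈ (μ.riserInput ct τ).cells.Hp i)
    (hcs : (μ.riserInput ct τ).IsCurtainSpecial i i' p) :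
    lawW (μ.riserInput ct τ).frameOf ((μ.riserInput ct τ).cells.cls i) ((μ.riserInput ct τ).cells.cls i') p.1 *
        facetArea ((μ.riserInput ct τ).contact i i' p) p.1 = 0 ∨
      (∃ (r : Fin rc.nr) (c : E3) (t : Fin 6), c ∈ μ.occF r ∧ polytope ((μ.riserInput ct τ).cells.Hp i) ⊆ polytope (μ.HB r) ∧
        polytope ((μ.riserInput ct τ).cells.Hp i') ⊆ polytope (μ.HB r) ∧ (μ.riserInput ct τ).grain i' ≠ (μ.riserInput ct τ).grain i ∧
        polytope ((μ.riserInput ct τ).cells.Hp i) ⊆ polytope (μ.hexPrism r c (μ.rlayer r c)) ∧ p = μ.hexWall r c t) ∨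
      (∃ (r : Fin rc.nr) (c : E3) (t : Fin 6), c ∈ μ.occF r ∧ polytope ((μ.riserInput ct τ).cells.Hp i') ⊆ polytope (μ.HB r) ∧
        polytope ((μ.riserInput ct τ).cells.Hp i) ⊆ polytope (μ.HB r) ∧ (μ.riserInput ct τ).grain i ≠ (μ.riserInput ct τ).grain i' ∧
        polytope ((μ.riserInput ct τ).cells.Hp i') ⊆ polytope (μ.hexPrism r c (μ.rlayer r c)) ∧ antip p = μ.hexWall r c t) := by
  have hne : i ≠ i' := (μ.riserInput ct τ).ne_of_cls_ne hcls
  by_cases hex : ∃ y ∈ (μ.riserInput ct τ).contact i i' p, (μ.riserInput ct τ).Generic p y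
  · obtain ⟨y, hy, hgen⟩ := hex
    by_cases hg : (μ.riserInput ct τ).grain i' = (μ.riserInput ct τ).grain i
    · left
      rw [(μ.riserInput ct τ).lawW_eq_zero_of_grain_eq hcls hg hy hgen, zero_mul]
    right
    obtain ⟨r, hi, hi', hprn⟩ := hcs
    have hrn1 : ⟪rc.rn r, rc.rn r⟫_ℝ = 1 := by rw [real_inner_self_eq_norm_sq, rc.hrn r, one_pow]
    rcases μ.grain_box_mem ct τ hi with hfi | hgi
    · -- `i` claimed: KEY⁺
      left
      obtain ⟨c, hc, hic⟩ := (μ.grain_box_eq_rtL_iff ct τ hi).1 hfi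
      have hi'c : ¬ polytope ((μ.riserInput ct τ).cells.Hp i') ⊆ polytope (μ.hexPrism r c (μ.rlayer r c)) := fun h =>
        hg (by rw [hfi, (μ.grain_box_eq_rtL_iff ct τ hi').2 ⟨c, hc, h⟩])
      have hpG := (μ.riserInput ct τ).mem_of_contact_of_subset hne hp hy hgen (μ.hexPrism_subset_𝓗 ct τ hc) hic hi'c
      rcases μ.mem_hexPrism_iff.1 hpG with ⟨t, ht⟩ | htop | hbot
      · exact ⟨r, c, t, hc, hi, hi', hg, hic, ht⟩
      · exfalso; rw [htop] at hprn; simp only at hprn; rw [hrn1] at hprn; exact one_ne_zero hprn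
      · exfalso; rw [hbot] at hprn; simp only [inner_neg_left] at hprn; rw [hrn1] at hprn; norm_num at hprn
    · -- `i` default: then `i'` is claimed: KEY⁻
      right
      have hfi' : (μ.riserInput ct τ).grain i' = rc.rtL r := by
        rcases μ.grain_box_mem ct τ hi' with h | h
        · exact h
        · exact absurd (h.trans hgi.symm) hg
      obtain ⟨c, hc, hi'c⟩ := (μ.grain_box_eq_rtL_iff ct τ hi').1 hfi'
      have hic : ¬ polytope ((μ.riserInput ct τ).cells.Hp i) ⊆ polytope (μ.hexPrism r c (μ.rlayer r c)) := fun h =>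
        hg (by rw [hfi', (μ.grain_box_eq_rtL_iff ct τ hi).2 ⟨c, hc, h⟩])
      have hpG := (μ.riserInput ct τ).antip_mem_of_contact_of_subset hne hp hy hgen (μ.hexPrism_subset_𝓗 ct τ hc) hi'c hic
      rcases μ.mem_hexPrism_iff.1 hpG with ⟨t, ht⟩ | htop | hbot
      · exact ⟨r, c, t, hc, hi', hi, Ne.symm hg, hi'c, ht⟩
      · exfalso
        have h1 := congrArg Prod.fst htop; simp only [antip] at h1
        have h2 : p.1 = -rc.rn r := by rw [← h1, neg_neg]
        rw [h2, inner_neg_left, hrn1] at hprn; norm_num at hprn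
      · exfalso
        have h1 := congrArg Prod.fst hbot; simp only [antip, neg_inj] at h1
        rw [h1, hrn1] at hprn; exact one_ne_zero hprn
  · left
    push Not at hex
    rw [(μ.riserInput ct τ).facetArea_contact_eq_zero_of_no_generic hp hex, mul_zero]

/-! ### A wall towards an occupied site carries no curtain -/

/-- **KEY⁺ with the neighbour across the wall OCCUPIED ⇒ the contact is null**: the default cell would enter the neighbour's prism and be claimed. -/
theorem facetArea_eq_zero_of_occupied_neighbour {j j' : Fin (μ.riserInput ct τ).cells.M} {q : E3 × ℝ} (hq : q ∈ (μ.riserInput ct τ).cells.Hp j)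
    {r : Fin rc.nr} {c : E3} {t : Fin 6} (hc : c ∈ μ.occF r) (hj : polytope ((μ.riserInput ct τ).cells.Hp j) ⊆ polytope (μ.HB r))
    (hj' : polytope ((μ.riserInput ct τ).cells.Hp j') ⊆ polytope (μ.HB r)) (hg : (μ.riserInput ct τ).grain j' ≠ (μ.riserInput ct τ).grain j)
    (hjc : polytope ((μ.riserInput ct τ).cells.Hp j) ⊆ polytope (μ.hexPrism r c (μ.rlayer r c))) (hqw : q = μ.hexWall r c t)
    (hocc : c + μ.rL r (sixDir t) ∈ rc.X') : facetArea ((μ.riserInput ct τ).contact j j' q) q.1 = 0 := by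
  obtain ⟨hcX, hcS, hcm⟩ := μ.mem_occF.1 hc
  obtain ⟨m, a, b, hce⟩ := μ.exists_eq_site hcS
  have hl : μ.rlayer r c = m := by rw [hce, μ.rlayer_site]
  have hgj : (μ.riserInput ct τ).grain j = rc.rtL r := (μ.grain_box_eq_rtL_iff ct τ hj).2 ⟨c, hc, hjc⟩
  rw [hl] at hjc hcm
  have hne : j ≠ j' := fun e => hg (by rw [e])
  refine (μ.riserInput ct τ).facetArea_contact_eq_zero_of_no_generic hq fun y hy hgen => ?_
  obtain ⟨a', b', hc'⟩ := μ.site_add_sixDir r m a b t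
  have hc't : c + μ.rL r (sixDir t) = μ.site r m a' b' := by rw [hce]; exact hc'
  rw [hc't] at hocc
  obtain ⟨hhex, hlo, hhi⟩ := μ.hexagon_of_mem_closure_hexPrism (closure_mono hjc hy.1.1)
  have hpt : ⟪μ.rL r (sixDir t), y - c⟫_ℝ = 1 / 2 := by
    have h := hy.1.2
    rw [hqw] at h
    simp only [hexWall, mem_setOf_eq] at h
    rw [inner_sub_right]; linarith
  have hhex' : ∀ s, ⟪μ.rL r (sixDir s), y - μ.site r m a' b'⟫_ℝ ≤ 1 / 2 := by
    intro s
    have := hexagon_step (μ.rL r) (y - c) hhex hpt s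
    rwa [sub_sub, hc't] at this
  have hc'occ : μ.site r m a' b' ∈ μ.occF r := μ.mem_occF.2 ⟨hocc, μ.site_mem r m a' b', by rw [μ.rlayer_site]; exact hcm⟩
  have hG' : μ.hexPrism r (μ.site r m a' b') m ⊆ (μ.riserInput ct τ).𝓗 := by
    have := μ.hexPrism_subset_𝓗 ct τ hc'occ; rwa [μ.rlayer_site] at this
  have hyG' := μ.closed_hexPrism_of_hexagon hhex' hlo hhi
  have hq' : antip q ∈ (μ.riserInput ct τ).cells.Hp j' := (μ.riserInput ct τ).antip_mem_Hp_of_contact hne hq hy hgen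
  obtain ⟨t', ht'⟩ := μ.hexWall_shift r c t
  rw [hc't, ← hqw] at ht'
  have haG' : antip q ∈ μ.hexPrism r (μ.site r m a' b') m := μ.mem_hexPrism_iff.2 (Or.inl ⟨t', ht'.symm⟩)
  have hqG' : antip (antip q) ∉ μ.hexPrism r (μ.site r m a' b') m := μ.antip_not_mem_hexPrism (μ.rheight_site r m a' b') haG'
  have hsub := (μ.riserInput ct τ).enter hq' hy.2 ((μ.riserInput ct τ).generic_antip hgen) hG' hyG' hqG'
  have hgj' : (μ.riserInput ct τ).grain j' = rc.rtL r :=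
    (μ.grain_box_eq_rtL_iff ct τ hj').2 ⟨μ.site r m a' b', hc'occ, by rw [μ.rlayer_site]; exact hsub⟩
  exact hg (hgj'.trans hgj.symm)

/-- The neighbour site across wall `t` is an `f`-site at distance `1`, in-plane. -/
theorem neighbour_site {r : Fin rc.nr} {c : E3} (hcS : c ∈ rc.S (rc.rtL r)) (t : Fin 6) :
    c + μ.rL r (sixDir t) ∈ rc.S (rc.rtL r) ∧ dist c (c + μ.rL r (sixDir t)) = 1 ∧ ⟪c + μ.rL r (sixDir t) - c, rc.rn r⟫_ℝ = 0 := by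
  obtain ⟨m, a, b, hce⟩ := μ.exists_eq_site hcS
  obtain ⟨a', b', h⟩ := μ.site_add_sixDir r m a b t
  refine ⟨?_, ?_, ?_⟩
  · rw [hce, h]; exact μ.site_mem r m a' b'
  · rw [dist_eq_norm, sub_add_cancel_left, norm_neg, LinearIsometryEquiv.norm_map, norm_sixDir]
  · rw [add_sub_cancel_left]; exact μ.inner_hexWall_rn r c t

end Mesh₅

/-! ### Who pays: the owner of the claimed site -/

namespace Mesh₇

variable {C R₀ : ℝ} {N : ℕ} {x : Fin N → E3} {rc : RiseredCover C R₀ N x} {δ : ℝ} (μ : Mesh₇ rc δ)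
  (ct : (f : Fin rc.ng) → TentCert (rc.tent f)) (τ : Fin rc.nk → ℝ)

/-- **A KEY⁺ TERM WITH NON-NULL CONTACT IS PAID FOR**: the claimed site `c` is owned by a riser piece `r'` of the same column pair, the vacant neighbour
`c + d` across the wall is one of its in-plane sites, and the owner's normal is `± rn r` (Δ3 `hBhalo`, `hBV`, Δ7 `hBownRn`). -/
theorem owner_of_key {j j' : Fin (μ.toMesh₅.riserInput ct τ).cells.M} {q : E3 × ℝ} (hq : q ∈ (μ.toMesh₅.riserInput ct τ).cells.Hp j)
    {r : Fin rc.nr} {c : E3} {t : Fin 6} (hc : c ∈ μ.toMesh₅.occF r) (hj : polytope ((μ.toMesh₅.riserInput ct τ).cells.Hp j) ⊆ polytope (μ.HB r))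
    (hj' : polytope ((μ.toMesh₅.riserInput ct τ).cells.Hp j') ⊆ polytope (μ.HB r))
    (hg : (μ.toMesh₅.riserInput ct τ).grain j' ≠ (μ.toMesh₅.riserInput ct τ).grain j)
    (hjc : polytope ((μ.toMesh₅.riserInput ct τ).cells.Hp j) ⊆ polytope (μ.toMesh₅.hexPrism r c (μ.toMesh₅.rlayer r c)))
    (hqw : q = μ.toMesh₅.hexWall r c t) (hA : facetArea ((μ.toMesh₅.riserInput ct τ).contact j j' q) q.1 ≠ 0) :
    ∃ r', c ∈ rc.rown r' ∧ c + μ.toMesh₅.rL r (sixDir t) ∈ rc.rV r' c ∧ c + μ.toMesh₅.rL r (sixDir t) ∉ rc.X' ∧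
      (rc.rn r' = rc.rn r ∨ rc.rn r' = -rc.rn r) := by
  have hvac : c + μ.toMesh₅.rL r (sixDir t) ∉ rc.X' := fun hocc =>
    hA (μ.toMesh₅.facetArea_eq_zero_of_occupied_neighbour ct τ hq hc hj hj' hg hjc hqw hocc)
  obtain ⟨hcX, hcS, -⟩ := μ.toMesh₅.mem_occF.1 hc
  obtain ⟨m, a, b, hce⟩ := μ.toMesh₅.exists_eq_site hcS
  have hch : μ.toMesh₅.rheight r c = (m : ℝ) * hB := by rw [hce, μ.toMesh₅.rheight_site]
  have hl : μ.toMesh₅.rlayer r c = m := by rw [hce, μ.toMesh₅.rlayer_site]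
  -- the box is within `1` of `c`
  obtain ⟨z, hz⟩ := (μ.toMesh₅.riserInput ct τ).cells.hne ((μ.toMesh₅.riserInput ct τ).cells.idx j)
  have hzG : z ∈ polytope (μ.toMesh₅.hexPrism r c m) := by rw [← hl]; exact hjc hz
  have hzc : dist z c < 1 := μ.toMesh₅.dist_lt_one_of_mem_hexPrism hch hzG
  have hinf : Metric.infDist c (polytope (μ.HB r)) < 1 :=
    lt_of_le_of_lt (Metric.infDist_le_dist_of_mem (hj hz)) (by rw [dist_comm]; exact hzc)
  obtain ⟨hvS, hdist, hperp⟩ := μ.toMesh₅.neighbour_site hcS t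
  rcases μ.hBhalo r c hcX (Or.inl hcS) hinf with ⟨r', hown, hpair⟩ | ⟨hall, -⟩
  · have hrn := μ.hBownRn r r' c hcX hown (Or.inr ⟨Or.inl hcS, hinf⟩)
    refine ⟨r', hown, ?_, hvac, hrn⟩
    have hperp' : ⟪c + μ.toMesh₅.rL r (sixDir t) - c, rc.rn r'⟫_ℝ = 0 := by
      rcases hrn with h | h
      · rw [h]; exact hperp
      · rw [h, inner_neg_right, hperp, neg_zero]
    obtain ⟨hV1, hV2⟩ := μ.hBV r' c hown
    rcases hpair with ⟨e1, -⟩ | ⟨-, e2⟩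
    · have hcS' : c ∈ rc.S (rc.rtL r') := by rw [e1]; exact hcS
      have hmem : c + μ.toMesh₅.rL r (sixDir t) ∈ (↑(rc.rV r' c) : Set E3) := by
        rw [hV1 hcS']; exact ⟨by rw [e1]; exact hvS, hdist, hperp'⟩
      exact hmem
    · have hcS' : c ∈ rc.S (rc.rtR r') := by rw [e2]; exact hcS
      have hmem : c + μ.toMesh₅.rL r (sixDir t) ∈ (↑(rc.rV r' c) : Set E3) := by
        rw [hV2 hcS']; exact ⟨by rw [e2]; exact hvS, hdist, hperp'⟩
      exact hmem
  · exact absurd (hall hcS _ hvS hdist hperp) hvac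

end Mesh₇

end Summit.Ventures.Crystal3D.Cruxes.TextureLiminf.TexShadow

end
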